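import Mathlib

/-!
# Route `NodalDiracTwist` — crux `NodalDiracWeakCoupling`, line `birth`: Möbius sign, part 4 (frame bookkeeping)

Helper file (`--supports stmt-HubbardSuperconductivity-10370`) for the lead's assembly stub
`stub_moebiusAbstract`: bookkeeping in the plane spanned by an orthonormal pair `e₁, e₂` of
`ι → ℂ` (sesquilinear dot product `⟨u, v⟩ = star u ⬝ᵥ v`):
* `frame_dot`, `frame_dot_frame`: overlaps of combinations `c e₁ + d e₂`;
* `pencil_coeff_linear`: the matrix elements of `c₀ V 0 + c₁ V 1` are linear in `(c₀, c₁)`;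
* `antiunitary_frame`: a conjugate-linear additive `T` fixing `e₁, e₂` fixes every REAL
  combination `x e₁ + y e₂`;
* `circlePoint_dist_sq`: the point `p + r (cos θ, sin θ)` (in the `if ν = 0 then cos else sin`
  spelling of the route statement) is at squared distance `r²` from `p`.
Folklore linear algebra; no definitions.
-/

-- the mandated namespace `Summit.<Summit>.<Problem>.Theorems` repeats `HubbardSuperconductivity`
-- (single-problem summit, D-0017), which the `dupNamespace` linter flags on every declaration
set_option linter.dupNamespace false

namespace Summit.HubbardSuperconductivity.HubbardSuperconductivity.Theorems.NodalDiracTwist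

open Matrix Complex
open scoped ComplexConjugate

variable {ι : Type*} [Fintype ι]

/-- Overlap of a frame combination with an arbitrary vector:
`⟨c e₁ + d e₂, w⟩ = c̄ ⟨e₁, w⟩ + d̄ ⟨e₂, w⟩`. [folklore] -/
theorem frame_dot (e₁ e₂ w : ι → ℂ) (c d : ℂ) :
    star (c • e₁ + d • e₂) ⬝ᵥ w = star c * (star e₁ ⬝ᵥ w) + star d * (star e₂ ⬝ᵥ w) := by
  rw [star_add, star_smul, star_smul, add_dotProduct, smul_dotProduct, smul_dotProduct,
    smul_eq_mul, smul_eq_mul]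

/-- Overlap of two frame combinations for an ORTHONORMAL pair `e₁, e₂`:
`⟨c e₁ + d e₂, c' e₁ + d' e₂⟩ = c̄ c' + d̄ d'`. [folklore] -/
theorem frame_dot_frame {e₁ e₂ : ι → ℂ} (he₁ : star e₁ ⬝ᵥ e₁ = 1) (he₂ : star e₂ ⬝ᵥ e₂ = 1)
    (he₁₂ : star e₁ ⬝ᵥ e₂ = 0) (c d c' d' : ℂ) :
    star (c • e₁ + d • e₂) ⬝ᵥ (c' • e₁ + d' • e₂) = star c * c' + star d * d' := by
  have he₂₁ : star e₂ ⬝ᵥ e₁ = 0 := by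
    have h : star e₂ ⬝ᵥ e₁ = star (star e₁ ⬝ᵥ e₂) := by
      rw [star_dotProduct]
    rw [h, he₁₂, star_zero]
  rw [frame_dot, dotProduct_add, dotProduct_add, dotProduct_smul, dotProduct_smul, dotProduct_smul,
    dotProduct_smul, he₁, he₂, he₁₂, he₂₁]
  simp only [smul_eq_mul, mul_one, mul_zero, add_zero, zero_add]

/-- The matrix elements of `c₀ V 0 + c₁ V 1` are linear in the coefficients. [folklore] -/
theorem pencil_coeff_linear (V : Fin 2 → Matrix ι ι ℂ) (e e' : ι → ℂ) (c₀ c₁ : ℂ) :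
    star e ⬝ᵥ ((c₀ • V 0 + c₁ • V 1) *ᵥ e') =
      c₀ * (star e ⬝ᵥ (V 0 *ᵥ e')) + c₁ * (star e ⬝ᵥ (V 1 *ᵥ e')) := by
  rw [add_mulVec, smul_mulVec, smul_mulVec, dotProduct_add, dotProduct_smul, dotProduct_smul,
    smul_eq_mul, smul_eq_mul]

omit [Fintype ι] in
/-- A conjugate-linear additive `T` fixing `e₁` and `e₂` fixes their real combinations.
[folklore] -/
theorem antiunitary_frame {T : (ι → ℂ) → (ι → ℂ)}
    (hTs : ∀ (c : ℂ) (v : ι → ℂ), T (c • v) = star c • T v)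
    (hTadd : ∀ u v : ι → ℂ, T (u + v) = T u + T v) {e₁ e₂ : ι → ℂ} (hTe₁ : T e₁ = e₁)
    (hTe₂ : T e₂ = e₂) (x y : ℝ) :
    T (((x : ℝ) : ℂ) • e₁ + ((y : ℝ) : ℂ) • e₂) = ((x : ℝ) : ℂ) • e₁ + ((y : ℝ) : ℂ) • e₂ := by
  rw [hTadd, hTs, hTs, hTe₁, hTe₂, Complex.star_def, Complex.conj_ofReal, Complex.conj_ofReal]

/-- The circle point `p + r (cos θ, sin θ)`, in the `if ν = 0 then cos else sin` spelling of the
route statement, is at squared distance `r²` from `p`. [folklore] -/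
theorem circlePoint_dist_sq (p : Fin 2 → ℝ) (r θ : ℝ) :
    ((fun ν : Fin 2 => p ν + r * (if ν = 0 then Real.cos θ else Real.sin θ)) 0 - p 0) ^ 2 +
      ((fun ν : Fin 2 => p ν + r * (if ν = 0 then Real.cos θ else Real.sin θ)) 1 - p 1) ^ 2 =
        r ^ 2 := by
  simp only [if_true, show (1 : Fin 2) ≠ 0 by decide, if_false, add_sub_cancel_left]
  have h := Real.cos_sq_add_sin_sq θ
  calc (r * Real.cos θ) ^ 2 + (r * Real.sin θ) ^ 2 = r ^ 2 * (Real.cos θ ^ 2 + Real.sin θ ^ 2) := by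
        ring
    _ = r ^ 2 := by rw [h, mul_one]

/-- The direction `(cos θ, sin θ)` in the route's spelling is a unit vector. [folklore] -/
theorem circleDir_unit (θ : ℝ) :
    (fun ν : Fin 2 => if ν = 0 then Real.cos θ else Real.sin θ) 0 ^ 2 +
      (fun ν : Fin 2 => if ν = 0 then Real.cos θ else Real.sin θ) 1 ^ 2 = 1 := by
  simp only [if_true, show (1 : Fin 2) ≠ 0 by decide, if_false]
  exact Real.cos_sq_add_sin_sq θ

end Summit.HubbardSuperconductivity.HubbardSuperconductivity.Theorems.NodalDiracTwist
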